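import Mathlib
import Summits.RiemannHypothesis.RiemannHypothesis.Theorems.IntegerScrewBracketWindow
import Summits.RiemannHypothesis.RiemannHypothesis.Theorems.IntegerScrewMixturePricing
import HarnessLib

/-!
# Route `IntegerScrew` — PRICING THE TILT: the mixture of windows against the profile `T(θ) = L/(log θ + λ)`
# is `O(1)·√D` (CONTINUUM-LIMIT §25.10 (d), §26.3)

THEOREM B's three-way split (`IntegerScrewExitAtomTilt.window_functional_sq_le_atom_tilt`) leaves the term
`(Σ_{1≤θ<Q} |T(θ+1) − T(θ)|·|Br(θ)|)²` with the brackets `Br(θ) = H_θ·G(Q)/H_Q − G(θ)` (`H_θ = Σ_{b≤θ}1/b`,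
`G(θ) = Σ_{b≤θ} g(b)/b`) on the all-integer bottom `Ω_Q` and the profile `T(θ) = L/(log θ + λ)` (`L = log R`,
`λ = log p`, `Q = R/p`; CONTINUUM-LIMIT 25.10 (b)).  This file prices it against the Dirichlet form
`D_Q(g) = Σ_{x≤Q}(1/x)Σ_{n∣x}Λ(n)(g(x) − g(x/n))²`:

* the bracket bounds `bracket_sq_le_theoremA` (`Br(θ)² ≤ 304500·(log Q/log(θ+1))·D_Q`, `149 ≤ θ ≤ Q/2`) and
  `bracket_sq_le_crude` (`Br(θ)² ≤ (33 log Q)²·D_Q`) of `IntegerScrewBracketWindow`;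
* `profile_sub_le` — `0 ≤ T(θ) − T(θ+1) ≤ L·(log(θ+1) − log θ)/λ²`, and the telescoping bounds
  `T(1) − T(149) ≤ 6L/λ²`, `T(Q/2+1) − T(Q) ≤ L·log 2/λ²`;
* `sub_div_sqrt_le` — `(a − b)/√a ≤ 2(√a − √b)` (`0 ≤ b`, `0 < a`): the telescoping device in `√log θ`;
* **`tilt_pricing`** — for `298 ≤ Q`, `0 < λ`, `0 ≤ L ≤ 2λ`, `log Q ≤ λ` (the cell: `L = log R < 2 log p`,
  `log Q ≤ log R − log p ≤ log p`) and every `g`: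
  `(Σ_{1≤θ<Q} |T(θ+1) − T(θ)|·|Br(θ)|)² ≤ 2700² · D_Q(g)`.

So the tilt of THEOREM B costs a BOUNDED multiple of the bottom's Dirichlet form — the pen estimate of
theory-gen16/README (b), which needs the window constant `κ_A = O(X²)` supplied by `IntegerScrewTheoremA` (with the
constant-`A` chain the sum is `≍ (log Q)^{1/4}`, unbounded).  RH-free, elementary.  Nothing in this file bears on the
truth of RH.
References: CONTINUUM-LIMIT §25.10, §26.3 (rh-explicit A6-PIVOT); M. Suzuki, J. Lond. Math. Soc. (2) 108 (2023)
1448–1487 [Suzuki2023] for the screw matrices this serves.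
-/

noncomputable section

set_option linter.dupNamespace false -- D-0017: `Summit.<S>.<S>.…` is the designed namespace

namespace Summit.RiemannHypothesis.RiemannHypothesis.Theorems.IntegerScrew

open Finset Real
open ArithmeticFunction (vonMangoldt)

/-! ### The profile `T(θ) = L/(log θ + λ)` -/

/-- `0 ≤ T(θ) − T(θ+1) ≤ L·(log(θ+1) − log θ)/λ²` for `θ ≥ 1`, `L ≥ 0`, `λ > 0`. -/
theorem profile_sub_le {L lam : ℝ} (hL : 0 ≤ L) (hlam : 0 < lam) {θ : ℕ} (hθ : 1 ≤ θ) :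
    0 ≤ L / (Real.log θ + lam) - L / (Real.log ((θ : ℝ) + 1) + lam) ∧
      L / (Real.log θ + lam) - L / (Real.log ((θ : ℝ) + 1) + lam) ≤
        L * (Real.log ((θ : ℝ) + 1) - Real.log θ) / lam ^ 2 := by
  have hθ1 : (1 : ℝ) ≤ θ := by exact_mod_cast hθ
  have ht : 0 ≤ Real.log (θ : ℝ) := Real.log_nonneg hθ1
  have hta : Real.log (θ : ℝ) ≤ Real.log ((θ : ℝ) + 1) := Real.log_le_log (by positivity) (by linarith)
  have hd1 : 0 < Real.log θ + lam := by linarith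
  have hd2 : 0 < Real.log ((θ : ℝ) + 1) + lam := by linarith
  have he : L / (Real.log θ + lam) - L / (Real.log ((θ : ℝ) + 1) + lam) =
      L * (Real.log ((θ : ℝ) + 1) - Real.log θ) / ((Real.log θ + lam) * (Real.log ((θ : ℝ) + 1) + lam)) := by
    field_simp
    ring
  rw [he]
  refine ⟨by positivity, ?_⟩
  exact div_le_div_of_nonneg_left (by positivity) (by positivity) (by nlinarith)

/-- The telescoping identity `Σ_{θ ∈ Ico m n} (f θ − f(θ+1)) = f m − f n` (`m ≤ n`). -/
theorem sum_Ico_sub_succ (f : ℕ → ℝ) {m n : ℕ} (hmn : m ≤ n) :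
    ∑ θ ∈ Ico m n, (f θ - f (θ + 1)) = f m - f n := by
  have h := Finset.sum_Ico_sub (f := f) hmn
  have : ∑ θ ∈ Ico m n, (f θ - f (θ + 1)) = -∑ θ ∈ Ico m n, (f (θ + 1) - f θ) := by
    rw [← Finset.sum_neg_distrib]
    exact Finset.sum_congr rfl fun θ _ => by ring
  rw [this, h]
  ring

/-- `(a − b)/√a ≤ 2(√a − √b)` for `0 ≤ b`, `0 < a` (since `2√a·√b ≤ a + b`). -/
theorem sub_div_sqrt_le {a b : ℝ} (ha : 0 < a) (hb : 0 ≤ b) :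
    (a - b) / Real.sqrt a ≤ 2 * (Real.sqrt a - Real.sqrt b) := by
  have hsa : 0 < Real.sqrt a := Real.sqrt_pos.2 ha
  have hsb : 0 ≤ Real.sqrt b := Real.sqrt_nonneg b
  have hsa2 : Real.sqrt a ^ 2 = a := Real.sq_sqrt ha.le
  have hsb2 : Real.sqrt b ^ 2 = b := Real.sq_sqrt hb
  rw [div_le_iff₀ hsa]
  nlinarith [sq_nonneg (Real.sqrt a - Real.sqrt b)]

/-! ### Two numerical inequalities -/

/-- `2·√304500·x·y ≤ 2208` for `0 ≤ x ≤ 2`, `0 ≤ y ≤ 1`. -/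
theorem pricing_numeric_mid {x y : ℝ} (hx0 : 0 ≤ x) (hx : x ≤ 2) (hy0 : 0 ≤ y) (hy : y ≤ 1) :
    2 * Real.sqrt 304500 * x * y ≤ 2208 := by
  have hs : Real.sqrt 304500 ≤ 552 := by
    have h := Real.sqrt_le_sqrt (show (304500 : ℝ) ≤ 552 ^ 2 by norm_num)
    rwa [Real.sqrt_sq (by norm_num : (0 : ℝ) ≤ 552)] at h
  have hs0 := Real.sqrt_nonneg 304500
  have hxy : x * y ≤ 2 := by nlinarith
  have hxy0 : 0 ≤ x * y := mul_nonneg hx0 hy0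
  calc 2 * Real.sqrt 304500 * x * y = 2 * Real.sqrt 304500 * (x * y) := by ring
    _ ≤ 2 * 552 * 2 := by nlinarith
    _ = 2208 := by norm_num

/-- `33·(6 + log 2)·x·y ≤ 443` for `0 ≤ x ≤ 2`, `0 ≤ y ≤ 1`. -/
theorem pricing_numeric_out {x y : ℝ} (hx0 : 0 ≤ x) (hx : x ≤ 2) (hy0 : 0 ≤ y) (hy : y ≤ 1) :
    33 * (6 + Real.log 2) * x * y ≤ 443 := by
  have hl2 := Real.log_two_lt_d9
  have hl2' := Real.log_two_gt_d9
  have hxy : x * y ≤ 2 := by nlinarith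
  have hxy0 : 0 ≤ x * y := mul_nonneg hx0 hy0
  have hc : 33 * (6 + Real.log 2) ≤ 221 := by linarith
  have hc0 : 0 ≤ 33 * (6 + Real.log 2) := by linarith
  calc 33 * (6 + Real.log 2) * x * y = 33 * (6 + Real.log 2) * (x * y) := by ring
    _ ≤ 221 * 2 := mul_le_mul hc hxy hxy0 (by norm_num)
    _ ≤ 443 := by norm_num

/-! ### The pricing -/

/-- **PRICING THE TILT (CONTINUUM-LIMIT §25.10 (d), §26.3).**  Let `298 ≤ Q`, `0 < λ`, `0 ≤ L ≤ 2λ`, `log Q ≤ λ`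
(in the cell of THEOREM B: `L = log R`, `λ = log p`, `Q = R/p`, `p² > R ≥ 298p`), `T(θ) = L/(log θ + λ)`,
`H_θ = Σ_{b≤θ}1/b`, `G(θ) = Σ_{b≤θ}g(b)/b`.  Then

  `(Σ_{1≤θ<Q} |T(θ+1) − T(θ)|·|H_θ·G(Q)/H_Q − G(θ)|)² ≤ 2700² · Σ_{x≤Q}(1/x)Σ_{n∣x}Λ(n)(g(x) − g(x/n))²`.

Proof: `sq_sum_mul_abs_le_of_sq_le` with `k_θ = √(304500·log Q/log(θ+1))` on `149 ≤ θ ≤ Q/2`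
(`bracket_sq_le_theoremA`) and `k_θ = 33 log Q` elsewhere (`bracket_sq_le_crude`); on the middle range
`|ΔT|·k ≤ (L√(304500 log Q)/λ²)·(log(θ+1) − log θ)/√log(θ+1) ≤ (2L√(304500 log Q)/λ²)·(√log(θ+1) − √log θ)`
telescopes to `≤ 2·552·(L/λ)(log Q/λ) ≤ 2208`; on `θ < 149` and `θ > Q/2` the profile drops by at most
`6L/λ²` and `L log 2/λ²`, giving `≤ 33·log Q·6.7·L/λ² ≤ 443`. -/
theorem tilt_pricing {Q : ℕ} (hQ : 298 ≤ Q) {L lam : ℝ} (hlam : 0 < lam) (hL0 : 0 ≤ L) (hL : L ≤ 2 * lam)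
    (hℓ : Real.log Q ≤ lam) (g : ℕ → ℝ) :
    (∑ θ ∈ Ico 1 Q, |L / (Real.log ((θ + 1 : ℕ) : ℝ) + lam) - L / (Real.log (θ : ℝ) + lam)| *
        |(∑ b ∈ Icc 1 θ, (1 : ℝ) / b) * (∑ b ∈ Icc 1 Q, g b / b) / (∑ b ∈ Icc 1 Q, (1 : ℝ) / b) -
          ∑ b ∈ Icc 1 θ, g b / b|) ^ 2 ≤
      2700 ^ 2 * ∑ x ∈ Icc 1 Q, (1 / (x : ℝ)) * ∑ n ∈ x.divisors, vonMangoldt n * (g x - g (x / n)) ^ 2 := by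
  set D := ∑ x ∈ Icc 1 Q, (1 / (x : ℝ)) * ∑ n ∈ x.divisors, vonMangoldt n * (g x - g (x / n)) ^ 2 with hD
  have hDnn : 0 ≤ D := Finset.sum_nonneg fun x _ => mul_nonneg (by positivity)
    (Finset.sum_nonneg fun n _ => mul_nonneg ArithmeticFunction.vonMangoldt_nonneg (sq_nonneg _))
  set ℓ := Real.log (Q : ℝ) with hℓdef
  set T : ℕ → ℝ := fun θ => L / (Real.log (θ : ℝ) + lam) with hT
  set N := Q / 2 with hN
  have hQr : (298 : ℝ) ≤ Q := by exact_mod_cast hQ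
  have hℓ5 : 5 ≤ ℓ := by
    have := five_le_log_succ (show 148 ≤ Q - 1 by omega)
    have hc : ((Q - 1 : ℕ) : ℝ) + 1 = Q := by
      rw [Nat.cast_sub (by omega : 1 ≤ Q)]; push_cast; ring
    rw [hc] at this; exact this
  have hℓ0 : 0 < ℓ := by linarith
  -- the window constants
  set k : ℕ → ℝ := fun θ => if 149 ≤ θ ∧ 2 * θ ≤ Q then Real.sqrt (304500 * ℓ / Real.log ((θ : ℝ) + 1))
    else 33 * ℓ with hk
  have hk0 : ∀ θ ∈ Ico 1 Q, 0 ≤ k θ := by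
    intro θ _; simp only [hk]; split_ifs
    · exact Real.sqrt_nonneg _
    · positivity
  -- the coefficients c θ = |T(θ+1) − T θ| = T θ − T(θ+1)
  have hcast : ∀ θ : ℕ, Real.log ((θ + 1 : ℕ) : ℝ) = Real.log ((θ : ℝ) + 1) := fun θ => by push_cast; ring_nf
  have hc_eq : ∀ θ, 1 ≤ θ → |L / (Real.log ((θ + 1 : ℕ) : ℝ) + lam) - L / (Real.log (θ : ℝ) + lam)| =
      T θ - T (θ + 1) := by
    intro θ hθ
    have hp := (profile_sub_le hL0 hlam hθ).1
    rw [hcast θ, abs_sub_comm, abs_of_nonneg hp]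
    simp only [hT]
    rw [hcast θ]
  -- Step 1: the pointwise bracket bounds
  have hx : ∀ θ ∈ Ico 1 Q,
      ((∑ b ∈ Icc 1 θ, (1 : ℝ) / b) * (∑ b ∈ Icc 1 Q, g b / b) / (∑ b ∈ Icc 1 Q, (1 : ℝ) / b) -
          ∑ b ∈ Icc 1 θ, g b / b) ^ 2 ≤ k θ ^ 2 * D := by
    intro θ hθ
    have hθ' := Finset.mem_Ico.1 hθ
    simp only [hk]
    split_ifs with hcase
    · have h := bracket_sq_le_theoremA g hcase.1 hcase.2
      rw [← hD] at h
      have harg : 0 ≤ 304500 * ℓ / Real.log ((θ : ℝ) + 1) := by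
        have : 0 < Real.log ((θ : ℝ) + 1) := Real.log_pos (by
          have : (149 : ℝ) ≤ θ := by exact_mod_cast hcase.1
          linarith)
        positivity
      rw [Real.sq_sqrt harg]
      calc _ ≤ 304500 * (ℓ / Real.log ((θ : ℝ) + 1)) * D := h
        _ = 304500 * ℓ / Real.log ((θ : ℝ) + 1) * D := by ring
    · have h := bracket_sq_le_crude g (show 149 ≤ Q by omega) hθ'.1 hθ'.2.le
      rw [← hD] at h
      exact h
  -- Step 2: the mixture pricing lemma
  have hmix := sq_sum_mul_abs_le_of_sq_le (s := Ico 1 Q)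
    (c := fun θ => |L / (Real.log ((θ + 1 : ℕ) : ℝ) + lam) - L / (Real.log (θ : ℝ) + lam)|)
    (x := fun θ => (∑ b ∈ Icc 1 θ, (1 : ℝ) / b) * (∑ b ∈ Icc 1 Q, g b / b) / (∑ b ∈ Icc 1 Q, (1 : ℝ) / b) -
          ∑ b ∈ Icc 1 θ, g b / b)
    (k := k) hDnn (fun θ _ => abs_nonneg _) hk0 hx
  refine hmix.trans (mul_le_mul_of_nonneg_right ?_ hDnn)
  -- Step 3: Σ c k ≤ 2700
  have hsum_nn : 0 ≤ ∑ θ ∈ Ico 1 Q,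
      |L / (Real.log ((θ + 1 : ℕ) : ℝ) + lam) - L / (Real.log (θ : ℝ) + lam)| * k θ :=
    Finset.sum_nonneg fun θ hθ => mul_nonneg (abs_nonneg _) (hk0 θ hθ)
  refine pow_le_pow_left₀ hsum_nn ?_ 2
  -- rewrite c as T θ − T(θ+1) and split the range at 149 and N+1
  have hre : ∑ θ ∈ Ico 1 Q, |L / (Real.log ((θ + 1 : ℕ) : ℝ) + lam) - L / (Real.log (θ : ℝ) + lam)| * k θ =
      ∑ θ ∈ Ico 1 Q, (T θ - T (θ + 1)) * k θ :=
    Finset.sum_congr rfl fun θ hθ => by rw [hc_eq θ (Finset.mem_Ico.1 hθ).1]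
  rw [hre]
  have hN1 : 149 ≤ N + 1 := by omega
  have hN2 : N + 1 ≤ Q := by omega
  rw [← Finset.sum_Ico_consecutive _ (show 1 ≤ 149 by norm_num) (le_trans hN1 hN2),
    ← Finset.sum_Ico_consecutive _ hN1 hN2]
  -- the profile's properties
  have hTanti : ∀ θ, 1 ≤ θ → 0 ≤ T θ - T (θ + 1) := fun θ hθ => by
    have := (profile_sub_le hL0 hlam hθ).1
    simp only [hT]; push_cast; exact this
  have hlam2 : 0 < lam ^ 2 := by positivity
  have hLl : L / lam ≤ 2 := by rw [div_le_iff₀ hlam]; linarith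
  have hℓl : ℓ / lam ≤ 1 := by rw [div_le_iff₀ hlam]; linarith
  -- (i) θ < 149: k = 33ℓ, Σ c = T 1 − T 149 ≤ 6L/λ²
  have hlog149 : Real.log (149 : ℝ) ≤ 6 := by
    rw [Real.log_le_iff_le_exp (by norm_num)]
    have h1 := Real.exp_one_gt_d9
    have h6 : Real.exp 6 = Real.exp 1 ^ 6 := by rw [← Real.exp_nat_mul]; norm_num
    rw [h6]
    have : (149 : ℝ) ≤ 2.7182818283 ^ 6 := by norm_num
    exact this.trans (pow_le_pow_left₀ (by norm_num) h1.le 6)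
  have hpart1 : ∑ θ ∈ Ico 1 149, (T θ - T (θ + 1)) * k θ ≤ 33 * ℓ * (6 * L / lam ^ 2) := by
    have hk1 : ∀ θ ∈ Ico 1 149, k θ = 33 * ℓ := by
      intro θ hθ; have := (Finset.mem_Ico.1 hθ).2
      simp only [hk]; rw [if_neg (by omega)]
    rw [Finset.sum_congr rfl fun θ hθ => by rw [hk1 θ hθ], ← Finset.sum_mul, sum_Ico_sub_succ T (by norm_num),
      mul_comm]
    refine mul_le_mul_of_nonneg_left ?_ (by positivity)
    -- T 1 − T 149 = L/λ − L/(log 149 + λ) = L log 149/(λ(log 149 + λ)) ≤ 6L/λ²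
    simp only [hT]
    push_cast
    rw [Real.log_one, zero_add]
    have hd : 0 < Real.log (149 : ℝ) + lam := by
      have := Real.log_pos (show (1 : ℝ) < 149 by norm_num); linarith
    have he : L / lam - L / (Real.log 149 + lam) = L * Real.log 149 / (lam * (Real.log 149 + lam)) := by
      field_simp
      ring
    rw [he, div_le_div_iff₀ (by positivity) hlam2]
    have h149 : 0 ≤ Real.log (149 : ℝ) := Real.log_nonneg (by norm_num)
    -- L log149 λ² ≤ 6L λ(log149 + λ)
    have e1 : L * Real.log 149 ≤ 6 * L := by
      have := mul_le_mul_of_nonneg_left hlog149 hL0; linarith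
    have e2 : lam ^ 2 ≤ lam * (Real.log 149 + lam) := by
      rw [sq]; exact mul_le_mul_of_nonneg_left (by linarith) hlam.le
    calc L * Real.log 149 * lam ^ 2 ≤ 6 * L * lam ^ 2 := mul_le_mul_of_nonneg_right e1 hlam2.le
      _ ≤ 6 * L * (lam * (Real.log 149 + lam)) := mul_le_mul_of_nonneg_left e2 (by positivity)
  -- (iii) θ ≥ N+1: k = 33ℓ, Σ c = T(N+1) − T Q ≤ L log 2/λ²
  have hpart3 : ∑ θ ∈ Ico (N + 1) Q, (T θ - T (θ + 1)) * k θ ≤ 33 * ℓ * (L * Real.log 2 / lam ^ 2) := by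
    have hk3 : ∀ θ ∈ Ico (N + 1) Q, k θ = 33 * ℓ := by
      intro θ hθ; have := (Finset.mem_Ico.1 hθ).1
      simp only [hk]; rw [if_neg (by omega)]
    rw [Finset.sum_congr rfl fun θ hθ => by rw [hk3 θ hθ], ← Finset.sum_mul, sum_Ico_sub_succ T hN2, mul_comm]
    refine mul_le_mul_of_nonneg_left ?_ (by positivity)
    simp only [hT]
    have hN1r : (1 : ℝ) ≤ ((N + 1 : ℕ) : ℝ) := by exact_mod_cast (show 1 ≤ N + 1 by omega)
    have hlogN : 0 ≤ Real.log ((N + 1 : ℕ) : ℝ) := Real.log_nonneg hN1r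
    have hQN : (Q : ℝ) ≤ 2 * ((N + 1 : ℕ) : ℝ) := by exact_mod_cast (show Q ≤ 2 * (N + 1) by omega)
    have hgap : ℓ - Real.log ((N + 1 : ℕ) : ℝ) ≤ Real.log 2 := by
      rw [hℓdef, ← Real.log_div (by positivity) (by positivity)]
      calc Real.log ((Q : ℝ) / ((N + 1 : ℕ) : ℝ)) ≤ Real.log 2 :=
            Real.log_le_log (by positivity) (by rw [div_le_iff₀ (by positivity)]; linarith)
        _ = Real.log 2 := rfl
    have hNQ' : Real.log ((N + 1 : ℕ) : ℝ) ≤ ℓ := Real.log_le_log (by positivity) (by exact_mod_cast hN2)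
    have hd1 : 0 < Real.log ((N + 1 : ℕ) : ℝ) + lam := by linarith
    have hd2 : 0 < ℓ + lam := by linarith
    have he : L / (Real.log ((N + 1 : ℕ) : ℝ) + lam) - L / (ℓ + lam) =
        L * (ℓ - Real.log ((N + 1 : ℕ) : ℝ)) / ((Real.log ((N + 1 : ℕ) : ℝ) + lam) * (ℓ + lam)) := by
      field_simp
      ring
    rw [he]
    calc L * (ℓ - Real.log ((N + 1 : ℕ) : ℝ)) / ((Real.log ((N + 1 : ℕ) : ℝ) + lam) * (ℓ + lam))
        ≤ L * Real.log 2 / ((Real.log ((N + 1 : ℕ) : ℝ) + lam) * (ℓ + lam)) :=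
          div_le_div_of_nonneg_right (mul_le_mul_of_nonneg_left hgap hL0) (by positivity)
      _ ≤ L * Real.log 2 / lam ^ 2 := by
          refine div_le_div_of_nonneg_left (mul_nonneg hL0 (Real.log_nonneg (by norm_num))) hlam2 ?_
          rw [sq]; exact mul_le_mul (by linarith) (by linarith) hlam.le (by linarith)
  -- (ii) 149 ≤ θ ≤ N: k = √(304500ℓ/log(θ+1)), telescoping in √log
  have hpart2 : ∑ θ ∈ Ico 149 (N + 1), (T θ - T (θ + 1)) * k θ ≤
      2 * L * Real.sqrt (304500 * ℓ) / lam ^ 2 * Real.sqrt ℓ := by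
    have hterm : ∀ θ ∈ Ico 149 (N + 1), (T θ - T (θ + 1)) * k θ ≤
        2 * L * Real.sqrt (304500 * ℓ) / lam ^ 2 *
          (Real.sqrt (Real.log ((θ : ℝ) + 1)) - Real.sqrt (Real.log (θ : ℝ))) := by
      intro θ hθ
      have hθ' := Finset.mem_Ico.1 hθ
      have hθ1 : 1 ≤ θ := by omega
      have hθr : (149 : ℝ) ≤ θ := by exact_mod_cast hθ'.1
      have hk2 : k θ = Real.sqrt (304500 * ℓ / Real.log ((θ : ℝ) + 1)) := by
        simp only [hk]; rw [if_pos ⟨hθ'.1, by omega⟩]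
      set a := Real.log ((θ : ℝ) + 1) with ha
      set b := Real.log (θ : ℝ) with hb
      have hb0 : 0 ≤ b := Real.log_nonneg (by linarith)
      have ha0 : 0 < a := Real.log_pos (by linarith)
      have hprof := (profile_sub_le hL0 hlam hθ1).2
      have hTsub : T θ - T (θ + 1) ≤ L * (a - b) / lam ^ 2 := by
        simp only [hT]; push_cast; exact hprof
      have hsq : Real.sqrt (304500 * ℓ / a) = Real.sqrt (304500 * ℓ) / Real.sqrt a := by
        rw [Real.sqrt_div' _ ha0.le]
      rw [hk2, hsq]
      have hsa : 0 < Real.sqrt a := Real.sqrt_pos.2 ha0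
      have hs3 : 0 ≤ Real.sqrt (304500 * ℓ) := Real.sqrt_nonneg _
      have hdev := sub_div_sqrt_le ha0 hb0
      calc (T θ - T (θ + 1)) * (Real.sqrt (304500 * ℓ) / Real.sqrt a)
          ≤ L * (a - b) / lam ^ 2 * (Real.sqrt (304500 * ℓ) / Real.sqrt a) :=
            mul_le_mul_of_nonneg_right hTsub (by positivity)
        _ = L * Real.sqrt (304500 * ℓ) / lam ^ 2 * ((a - b) / Real.sqrt a) := by
            field_simp
        _ ≤ L * Real.sqrt (304500 * ℓ) / lam ^ 2 * (2 * (Real.sqrt a - Real.sqrt b)) :=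
            mul_le_mul_of_nonneg_left hdev (by positivity)
        _ = 2 * L * Real.sqrt (304500 * ℓ) / lam ^ 2 * (Real.sqrt a - Real.sqrt b) := by ring
    refine (Finset.sum_le_sum hterm).trans ?_
    rw [← Finset.mul_sum]
    refine mul_le_mul_of_nonneg_left ?_ (by positivity)
    -- telescoping: Σ (√log(θ+1) − √log θ) = √log(N+1) − √log 149 ≤ √ℓ
    have htel := Finset.sum_Ico_sub (f := fun θ : ℕ => Real.sqrt (Real.log (θ : ℝ))) hN1
    have hre2 : ∑ θ ∈ Ico 149 (N + 1), (Real.sqrt (Real.log ((θ : ℝ) + 1)) - Real.sqrt (Real.log (θ : ℝ))) =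
        ∑ θ ∈ Ico 149 (N + 1), (Real.sqrt (Real.log ((θ + 1 : ℕ) : ℝ)) - Real.sqrt (Real.log (θ : ℝ))) :=
      Finset.sum_congr rfl fun θ _ => by push_cast; ring_nf
    rw [hre2, htel]
    have h1 : Real.sqrt (Real.log ((N + 1 : ℕ) : ℝ)) ≤ Real.sqrt ℓ :=
      Real.sqrt_le_sqrt (Real.log_le_log (by positivity) (by exact_mod_cast hN2))
    have h2 : 0 ≤ Real.sqrt (Real.log ((149 : ℕ) : ℝ)) := Real.sqrt_nonneg _
    linarith
  -- Step 4: numerics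
  have hsℓ : Real.sqrt (304500 * ℓ) * Real.sqrt ℓ = Real.sqrt 304500 * ℓ := by
    rw [Real.sqrt_mul (by norm_num) ℓ, mul_assoc, Real.mul_self_sqrt hℓ0.le]
  have hLl0 : 0 ≤ L / lam := by positivity
  have hℓl0 : 0 ≤ ℓ / lam := by positivity
  have hmid : 2 * L * Real.sqrt (304500 * ℓ) / lam ^ 2 * Real.sqrt ℓ ≤ 2208 := by
    have e : 2 * L * Real.sqrt (304500 * ℓ) / lam ^ 2 * Real.sqrt ℓ =
        2 * Real.sqrt 304500 * (L / lam) * (ℓ / lam) := by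
      rw [show 2 * L * Real.sqrt (304500 * ℓ) / lam ^ 2 * Real.sqrt ℓ =
          2 * L * (Real.sqrt (304500 * ℓ) * Real.sqrt ℓ) / lam ^ 2 by ring, hsℓ]
      field_simp
    rw [e]
    exact pricing_numeric_mid hLl0 hLl hℓl0 hℓl
  have hout : 33 * ℓ * (6 * L / lam ^ 2) + 33 * ℓ * (L * Real.log 2 / lam ^ 2) ≤ 443 := by
    have e : 33 * ℓ * (6 * L / lam ^ 2) + 33 * ℓ * (L * Real.log 2 / lam ^ 2) =
        33 * (6 + Real.log 2) * (L / lam) * (ℓ / lam) := by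
      field_simp
    rw [e]
    exact pricing_numeric_out hLl0 hLl hℓl0 hℓl
  linarith [hpart1, hpart2, hpart3, hmid, hout]

end Summit.RiemannHypothesis.RiemannHypothesis.Theorems.IntegerScrew

end
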